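/-
Copyright (c) 2026 the pub-hodgecm-mathlib formalisation cell (harness21).  Prover seat hodgecm-mathlib-R90-C10-p08 (g2), SLAB R90-TF, section S1 «Ch. 10∕12 local»;
crux H413 = `stmt-HodgeConjecture-24833`; line (D-1) «B_pos» of U4Keys :182 (S1 A2′), card (B-10)(1) = census `R90/R90-C10-p08/g2/CENSUS-Bpos-ramified-posdepth.md` §2 (a)(b),
§5 (1) (R90-C10-plan (g2) R-S1-18 2026-09-05T00:17:38Z).  KERNEL module: THEOREMS ONLY (no definition, no named fact, no `sorry`, no instance, no notation).  2026-09-05.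
-/
import Literature.NumberTheory.Rogawski1990.SemilocalQuadraticCharExtension     -- ★ `exists_units_map_toLocalRing_eq_of_conjLocal_eq` (a `σ`-fixed unit of `L ⊗ L⁺_v` is `ι_v t`); brings ★ `toLocalRing_apply`, ★ `conjLocal_toLocalRing`, ★ `valued_toPlace`
import Literature.NumberTheory.LocalFields.CompleteValuedSquareRootNearOne      -- ★ `exists_mul_self_eq_of_valued_sub_one_lt_four_adicCompletion` (Hensel: square roots near `1` in `K_v`)
import HarnessLib

/-!
# R90-TF S1 «Ch10-local» ∕ K2 E3 «U4Keys» :182, BRANCH B AT POSITIVE DEPTH — brick (B-10)(1): IN BRANCH B, `χ₁ = 1` ON THE `σ`-FIXED PRINCIPAL UNITS AT EVERY TAME PLACE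
# «`u = ι_v t`, `t ≡ 1 (𝔭_v)` ⟹ `t = r²` (Hensel, `|2|_v = 1`) ⟹ `u = (ι_v r)·σ(ι_v r)` ⟹ `χ₁ u = 1` by `hB`» — the letter `hfixP` of (B-10)(4) and `hcondF` at every level `c ≥ 1`, RAMIFIED places included
# [Serre1979 Ch. II §4 Prop. 7, Ch. XIV §4; Rogawski1990 §3.8, §12.2 (2); Roche1998 §3; Keys1984 §7 Thm (2)]

Cell `pub/hodgecm-mathlib`, crux H413 = `stmt-HodgeConjecture-24833`, route of record `HCCMUnconditional` (no route verbs); R90-TF section S1.  THEOREMS ONLY; lane `--supports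
stmt-HodgeConjecture-24833 --as helper`, count-neutral.  NOT THE PAYER of :182.
WHAT.  The θ-multiplicativity of ★ p862709 `theta_mul_concave` and (B-8) ★ p863496 `R90S1BposCongruencePackTheta` take the letter `hcondF` «`χ₁ u = 1` for every `σ`-fixed unit `u`
of `L ⊗ L⁺_v` with `|u_{w′} − 1|_{w′} ≤ |ϖ|ᶜ`» (`1 ≤ c`), and the conductor-parity lemma (B-10)(4) `R90S1BposRamConductorEven` (p06 (g3)) takes the letter `hfixP` «`χ₁ u = 1` for every
unit `u` with `|u_{w′} − 1| < 1` at every `w′` and `(c ⊗ 1) u = u`».  At an INERT place the inert line discharges both from `hB` by ★ `apply_eq_one_of_branchB_of_fixed (hns hunr χ₁ hB)`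
(every `σ`-fixed unit-integer is a norm of a unit — FALSE at a ramified place: the residue quadratic character obstructs, ★ `RamifiedPlaceUnitNorms`).  THIS FILE discharges them at
EVERY place `w ∣ v` with `|2|_w = 1` (ramified or not, no non-split hypothesis) for the PRINCIPAL `σ`-fixed units, which is all the letters ask: a `σ`-fixed unit is `u = ι_v t`,
`t ∈ L⁺_vˣ` (★ `exists_units_map_toLocalRing_eq_of_conjLocal_eq`); `|ι_w(t − 1)|_w = |t − 1|_v^{e(w|v)} < 1` forces `|t − 1|_v < 1 = |4|_v` (★ `valued_toPlace`; `|2|_v^{e} = |2|_w = 1`),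
so `t = r·r` in `L⁺_v` (★ Hensel `exists_mul_self_eq_of_valued_sub_one_lt_four_adicCompletion`), and `a := ι_v r` is a `σ`-FIXED unit (★ `conjLocal_toLocalRing`) with `|a_{w′}|² =
|u_{w′}| = 1` and `u = a·σa` — so `χ₁ u = 1` is the Branch-B hypothesis `hB` itself.  Census §2: (a) this lemma; (b) `hcondF` at `c = 1` = the F-slot `k = 0` of the ramified corner;
(c) conductor parity (consumer: (B-10)(4)).
* §1 **`apply_eq_one_of_branchB_of_fixed_principal_ram (h2w) (χ₁) (hB) (u) (hu) (hσu)`** — `χ₁ u = 1`; partially applied at `(h2w) (χ₁) (hB)` it IS the letter `hfixP` of (B-10)(4)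
  byte for byte (`∀ u, (∀ w', Valued.v (((u : LocalRing L v) w') - 1) < 1) → conjLocal L (IsCMField.complexConj L) v (u : LocalRing L v) = u → χ₁ u = 1`).
* §2 **`hcondF_of_branchB_of_tame (h2w) (hϖ) (hc) (χ₁) (hB)`** — the letter `hcondF` of ★ p862709 ∕ ★ p863496 at every level `c ≥ 1` (`Units.map` spelling, `Valued.v ϖ ^ c` currency).
HONEST LABEL.  HC_CM is proved only modulo the 7 printed citations (2 remaining named inputs: hLiu418 = `stmt-HodgeConjecture-24832`, h413 = `stmt-HodgeConjecture-24833`) until rung 0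
closes; count-neutral — this file pays NO socket (:182 and A2′ stay OPEN); no printed citation is discharged; the wild corner (`v ∣ 2`) is not addressed.

## References
* [Serre1979] J.-P. Serre, *Local Fields*, GTM 67 (1979), Ch. II §4 Prop. 7 and Ch. XIV §4 (squares near `1`); Ch. V §3 (tame ramified unit norms).
* [Rogawski1990] J. D. Rogawski, *Automorphic Representations of Unitary Groups in Three Variables*, Ann. of Math. Stud. 123 (1990), §3.8 Prop. 3.8.1 (d) p. 30; §12.2 (2) p. 173.
* [Roche1998] A. Roche, *Types and Hecke algebras for principal series representations of split reductive p-adic groups*, Ann. Sci. ÉNS (4) 31 (1998), §3 (the conductors `c_α`).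
* [Keys1984] D. Keys, *Principal series representations of special unitary groups over local fields*, Compositio Math. 51 (1984), §7 Theorem (2) p. 126.
-/

set_option autoImplicit false
-- the mandated namespace has the single-problem summit's repeated segment (`HodgeConjecture.HodgeConjecture`)
set_option linter.dupNamespace false

noncomputable section

open NumberField IsDedekindDomain
open Literature.NumberTheory Literature.NumberTheory.Automorphic Literature.NumberTheory.Automorphic.UnitaryGroup
open Literature.NumberTheory.Rogawski1990

namespace Summit.HodgeConjecture.HodgeConjecture.R90.S1.BposRamFixedPrincipalUnits

variable (L : Type) [Field L] [NumberField L] [IsCMField L] (v : HeightOneSpectrum (𝓞 ↥(maximalRealSubfield L))) (w : PlacesOver L v)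

/-! ## §1 `χ₁ = 1` on the `σ`-fixed principal units, from `hB` alone, at a place with `|2|_w = 1` -/

/-- **BRANCH B ⟹ `χ₁ = 1` ON THE `σ`-FIXED PRINCIPAL UNITS** at a place `w ∣ v` with `|2|_w = 1` — ramified places INCLUDED, no non-split hypothesis.  For a unit `u` of `L ⊗ L⁺_v`
with `|u_{w′} − 1|_{w′} < 1` at every `w′ ∣ v` and `(c ⊗ 1) u = u`: `χ₁ u = 1`, where `hB` is the Branch-B hypothesis «`χ₁(a · σa) = 1` for every unit `a` with `|a_{w′}| = 1`».
Partially applied at `(h2w) (χ₁) (hB)` this is the letter `hfixP` of (B-10)(4) `R90S1BposRamConductorEven`.  Proof: `u = ι_v t` (★ `exists_units_map_toLocalRing_eq_of_conjLocal_eq`);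
`|t − 1|_v < 1` because `|ι_w(t − 1)|_w = |t − 1|_v^{e(w|v)}` (★ `valued_toPlace`, `e ≠ 0`); `|4|_v = 1` (`|2|_v^{e} = |2|_w = 1`); Hensel (★ `exists_mul_self_eq_of_valued_sub_one_lt_four_adicCompletion`)
gives `t = r·r`; `a := ι_v r` is `σ`-fixed (★ `conjLocal_toLocalRing`), a unit with `|a_{w′}|² = |u_{w′}| = 1`, and `u = a·σa`.
[cite: Serre1979, Ch. II §4 Prop. 7; Ch. XIV §4] [cite: Rogawski1990, §3.8 Prop. 3.8.1 (d) p. 30; §12.2 (2) p. 173] [cite: Keys1984, §7 Theorem (2) p. 126] -/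
theorem apply_eq_one_of_branchB_of_fixed_principal_ram (h2w : Valued.v (2 : w.1.adicCompletion L) = 1)
    (χ₁ : (LocalRing L v)ˣ →* ℂˣ)
    (hB : ∀ u : (LocalRing L v)ˣ, (∀ w' : PlacesOver L v, Valued.v ((u : LocalRing L v) w') = 1) →
      χ₁ (u * Units.map (conjLocal L (IsCMField.complexConj L) v : LocalRing L v →* LocalRing L v) u) = 1)
    (u : (LocalRing L v)ˣ) (hu : ∀ w' : PlacesOver L v, Valued.v (((u : LocalRing L v) w') - 1) < 1)
    (hσu : conjLocal L (IsCMField.complexConj L) v (u : LocalRing L v) = u) : χ₁ u = 1 := by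
  -- `u = ι_v t`
  obtain ⟨t, ht⟩ := exists_units_map_toLocalRing_eq_of_conjLocal_eq v u hσu
  have htw : ∀ w' : PlacesOver L v, (u : LocalRing L v) w' = toPlace v w' (t : v.adicCompletion ↥(maximalRealSubfield L)) := fun w' => by
    rw [← ht, Units.coe_map, MonoidHom.coe_coe, toLocalRing_apply]
  -- `e(w|v) ≠ 0`
  have he0 : v.asIdeal.ramificationIdx' w.1.asIdeal ≠ 0 := by
    haveI := PlacesOver.liesOver w
    exact Ideal.IsDedekindDomain.ramificationIdx'_ne_zero_of_liesOver w.1.asIdeal v.ne_bot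
  -- `|t − 1|_v < 1`
  have ht1 : Valued.v ((t : v.adicCompletion ↥(maximalRealSubfield L)) - 1) < 1 := by
    have h := hu w
    rw [htw w, ← map_one (toPlace v w), ← map_sub, valued_toPlace] at h
    exact (pow_lt_one_iff he0).1 h
  -- `|2|_v = 1`, hence `|4|_v = 1`
  have h2v : Valued.v (2 : v.adicCompletion ↥(maximalRealSubfield L)) = 1 := by
    have h := h2w
    rw [← map_ofNat (toPlace v w) 2, valued_toPlace] at h
    exact le_antisymm ((pow_le_one_iff he0).1 h.le) ((one_le_pow_iff he0).1 h.ge)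
  have h4v : Valued.v (4 : v.adicCompletion ↥(maximalRealSubfield L)) = 1 := by
    rw [show (4 : v.adicCompletion ↥(maximalRealSubfield L)) = 2 * 2 by norm_num, map_mul, h2v, mul_one]
  -- Hensel: `t = r·r`
  obtain ⟨r, hr, -⟩ := LocalFields.exists_mul_self_eq_of_valued_sub_one_lt_four_adicCompletion ↥(maximalRealSubfield L) v
    (t : v.adicCompletion ↥(maximalRealSubfield L)) (by rw [h4v]; exact ht1)
  -- `a := ι_v r`: a `σ`-fixed unit with `a·a = u`
  have haa : toLocalRing L v r * toLocalRing L v r = (u : LocalRing L v) := by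
    rw [← map_mul, hr, ← ht, Units.coe_map, MonoidHom.coe_coe]
  have haU : IsUnit (toLocalRing L v r) := isUnit_of_mul_isUnit_left (by rw [haa]; exact u.isUnit)
  have hσa : Units.map (conjLocal L (IsCMField.complexConj L) v : LocalRing L v →* LocalRing L v) haU.unit = haU.unit :=
    Units.ext (by rw [Units.coe_map, MonoidHom.coe_coe, IsUnit.unit_spec, conjLocal_toLocalRing])
  have hua : u = haU.unit * Units.map (conjLocal L (IsCMField.complexConj L) v : LocalRing L v →* LocalRing L v) haU.unit := by
    rw [hσa]
    exact Units.ext (by rw [Units.val_mul, IsUnit.unit_spec, haa])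
  -- `|u_{w′}| = 1` (`u_{w′} = 1 + (u_{w′} − 1)`), hence `|a_{w′}| = 1` (`|a_{w′}|² = |u_{w′}|`)
  have hu1 : ∀ w' : PlacesOver L v, Valued.v ((u : LocalRing L v) w') = 1 := fun w' => by
    have h := hu w'
    have e : (u : LocalRing L v) w' = 1 + ((u : LocalRing L v) w' - 1) := by ring
    rw [e, Valuation.map_one_add_of_lt _ h]
  have ha1 : ∀ w' : PlacesOver L v, Valued.v ((haU.unit : LocalRing L v) w') = 1 := fun w' => by
    rw [IsUnit.unit_spec]
    have h := hu1 w'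
    rw [← haa, Pi.mul_apply, map_mul, ← pow_two] at h
    exact le_antisymm ((pow_le_one_iff two_ne_zero).1 h.le) ((one_le_pow_iff two_ne_zero).1 h.ge)
  rw [hua]
  exact hB haU.unit ha1

/-- JUNCTION (B-10)(1) → (B-10)(4): §1 partially applied at `(h2w) (χ₁) (hB)` has EXACTLY the type of the letter `hfixP` of `R90S1BposRamConductorEven.odd_of_conductorLetters_of_fixedPrincipal`
(p06 (g3), 📤 p863739; binder bytes copied from its head) — the leaf feeds `hfixP := apply_eq_one_of_branchB_of_fixed_principal_ram L v w h2w χ₁ hB`, no shim. [cite: Keys1984, §7 Theorem (2) p. 126] -/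
example (h2w : Valued.v (2 : w.1.adicCompletion L) = 1) (χ₁ : (LocalRing L v)ˣ →* ℂˣ)
    (hB : ∀ u : (LocalRing L v)ˣ, (∀ w' : PlacesOver L v, Valued.v ((u : LocalRing L v) w') = 1) →
      χ₁ (u * Units.map (conjLocal L (IsCMField.complexConj L) v : LocalRing L v →* LocalRing L v) u) = 1) :
    ∀ u : (LocalRing L v)ˣ, (∀ w' : PlacesOver L v, Valued.v (((u : LocalRing L v) w') - 1) < 1) →
      conjLocal L (IsCMField.complexConj L) v (u : LocalRing L v) = u → χ₁ u = 1 :=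
  apply_eq_one_of_branchB_of_fixed_principal_ram L v w h2w χ₁ hB

/-! ## §2 The letter `hcondF` at every level `c ≥ 1` -/

/-- **THE LETTER `hcondF` OF ★ p862709 `theta_mul_concave` ∕ ★ p863496 (B-8) AT A PLACE WITH `|2|_w = 1`, FROM `hB`**: for `1 ≤ c` and the frame's uniformiser `ϖ` of `L_w`
(`|ϖ|_w = exp(−1)`), every `σ`-fixed unit `u` (`Units.map (c ⊗ 1) u = u`) with `|u_{w′} − 1|_{w′} ≤ |ϖ|ᶜ` at every `w′ ∣ v` has `χ₁ u = 1` (`|ϖ|ᶜ < 1`, then §1).  At an inert place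
this is the inert line's discharge (★ `apply_eq_one_of_branchB_of_fixed`, all `σ`-fixed unit-integers); here ramified places are included and only `|2|_w = 1` is used — the F-slot
of the ramified positive-depth corner is `c = 1` (`k = 0`, census §2 (b)). [cite: Roche1998, §3] [cite: Keys1984, §7 Theorem (2) p. 126] [cite: Serre1979, Ch. II §4 Prop. 7] -/
theorem hcondF_of_branchB_of_tame (h2w : Valued.v (2 : w.1.adicCompletion L) = 1)
    {ϖ : w.1.adicCompletion L} (hϖ : Valued.v ϖ = WithZero.exp (-1 : ℤ)) {c : ℕ} (hc : 1 ≤ c)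
    (χ₁ : (LocalRing L v)ˣ →* ℂˣ)
    (hB : ∀ u : (LocalRing L v)ˣ, (∀ w' : PlacesOver L v, Valued.v ((u : LocalRing L v) w') = 1) →
      χ₁ (u * Units.map (conjLocal L (IsCMField.complexConj L) v : LocalRing L v →* LocalRing L v) u) = 1) :
    ∀ u : (LocalRing L v)ˣ, Units.map (conjLocal L (IsCMField.complexConj L) v : LocalRing L v →* LocalRing L v) u = u →
      (∀ w' : PlacesOver L v, Valued.v (((u : LocalRing L v) w') - 1) ≤ Valued.v ϖ ^ c) → χ₁ u = 1 := by
  intro u hσu hu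
  have hϖ1 : Valued.v ϖ < 1 := by
    rw [hϖ, ← WithZero.exp_zero, WithZero.exp_lt_exp]
    norm_num
  have hϖc : Valued.v ϖ ^ c < 1 := (pow_lt_one_iff (by omega)).2 hϖ1
  have hσu' : conjLocal L (IsCMField.complexConj L) v (u : LocalRing L v) = u := by
    have h := congrArg Units.val hσu
    simpa only [Units.coe_map, MonoidHom.coe_coe] using h
  exact apply_eq_one_of_branchB_of_fixed_principal_ram L v w h2w χ₁ hB u (fun w' => lt_of_le_of_lt (hu w') hϖc) hσu'

end Summit.HodgeConjecture.HodgeConjecture.R90.S1.BposRamFixedPrincipalUnits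

end
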